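import Summits.AtomisticToContinuum.Crystallization.Theorems.ExcessDecayLiouvillePhononStabilityVtxDefs
import Summits.AtomisticToContinuum.Crystallization.Theorems.ExcessDecayLiouvillePhononStabilityCertAssembly

/-!
# Strategy census sketch — crux `PhononStability` (stmt-AtomisticToContinuum-9333), strategist s1

Typed signatures quoted in `STRATEGY-CENSUS.md` (crux-strategist unit `cstrat-stmt-AtomisticToContinuum-9333-s1`):

* `## Strengthen`: the rigid form S⁺ actually in play is the live line's cell format — `nearCertificate_of_cells`
  (landed, `…CertAssembly`): finitely many `CellPack`s with `cells.all (cellOK P) = true` and a chart cover give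
  `NearCertificate`.  Recorded here as the Prop `CellsCertificate` (its hypotheses bundled).
* `## Decomposition` / hedge recipe: the Fourier-side split of the open stub `NearCertificateF` into
  `BlochReductionPair` (Plancherel for finite-range pair forms on the labelled two-lattice `Fin 2 × ℤ³`; analytic,
  reusable) and `NearSymbolCertificateF` (positive-semidefiniteness of the 6×6 symbol of the near pair form at every
  datum of the fundamental-domain window, θ split at radius `θ₀` into a long-wave and a short-wave obligation), with the
  glue `nearCertificateF_of_symbol`.  NOT registered as a line (census verdict: hedge only; trigger = an SOS gap at the
  hard nodes of the live vertex scheme).  Sorries mark what a hedge line would have to prove.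
-/

noncomputable section

open scoped BigOperators Classical InnerProductSpace ComplexConjugate
open Filter Set Function
open Summit.AtomisticToContinuum.Crystallization.Theorems.PhononStabilityNegative
open Summit.AtomisticToContinuum.Crystallization.Theorems.PhononStabilityCWC
open Summit.AtomisticToContinuum.Crystallization.Theorems.PhononStabilityCWC.Cert

namespace Summit.AtomisticToContinuum.Crystallization.Cruxes.PhononStability.StrategistS1

local notation "E3" => EuclideanSpace ℝ (Fin 3)

/-! ## Strengthen: the S⁺ of the live line, as one Prop -/

/-- **S⁺ (cells certificate)** — the hypotheses of the landed `nearCertificate_of_cells` bundled: certificate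
parameters, a finite list of cells each passing the ONE native Boolean check, the arithmetic side conditions, and a
cover of the window by the cells' chart boxes.  `CellsCertificate → NearCertificate` is `nearCertificate_of_cells`
(given `ChainBound`, `PathBound`, both landed).  Strictly stronger than positivity (sum-of-squares representability with
star-supported Gram data per cell); the rigidity buys a millisecond kernel check per node but NO reduction of the node
count, which is set by the curvature of `ω` (`ω‴(0.945) ≈ −1.8·10⁵`) against the margin `0.105 − κ`. -/
def CellsCertificate : Prop :=
  ∃ (P : Params) (cells : List CellPack) (Rn Rf Rinf : ℝ) (bn bf bi : ℕ) (qi : ℤ) (D : ℕ),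
    cells.all (cellOK P) = true ∧ 0 < P.κ ∧ ⌈2 * Rn⌉₊ + 1 = bn ∧ ((P.qn : ℤ) : ℝ) = 36 * Rn ^ 2 ∧
    ⌈2 * Rf⌉₊ + 1 = bf ∧ ((P.qf : ℤ) : ℝ) = 36 * Rf ^ 2 ∧ ⌈2 * Rinf⌉₊ + 1 = bi ∧ ((qi : ℤ) : ℝ) = 36 * Rinf ^ 2 ∧
    2 ≤ Rn ∧ Rn ≤ Rf ∧ Rf ≤ Rinf ∧ 100 ≤ Rinf ∧ validChainsB P.qn P.qf = true ∧ chainsNN P.qn P.qf = true ∧ 0 < D ∧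
    ((sumRange (fun c => (midCeil D c : ℚ)) P.qf qi : ℚ) : ℝ) / D + 40000 / Rinf ^ 3 ≤ P.K ∧
    ∀ (A B : E3 →L[ℝ] E3) (δ : E3), CellWindow A → ShiftWindow A δ →
      ∃ ck ∈ cells, ∀ p ∈ boxList9 ck.hbox, |chartX ck.cd A B δ p.1| ≤ (p.2 : ℝ)

/-- `S⁺ → NearCertificate` is the landed assembly (modulo the two landed far-field stubs). [folklore] -/
theorem nearCertificate_of_cellsCertificate (hC : ChainBound) (hP : PathBound) (h : CellsCertificate) :
    NearCertificate := by
  obtain ⟨P, cells, Rn, Rf, Rinf, bn, bf, bi, qi, D, hok, hκ, hbn, hqn, hbf, hqf, hbi, hqi, hRn, hRnf, hRfi, hRinf,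
    hvalid, hnn, hD, hK, hcover⟩ := h
  exact nearCertificate_of_cells hC hP P cells hok hκ hbn hqn hbf hqf hbi hqi hRn hRnf hRfi hRinf hvalid hnn hD hK hcover

/-! ## Decomposition / hedge: finite-range pair forms and their Bloch symbol -/

/-- A finite-range PAIR FORM on label fields: `Σ_{c ∈ s} Σ_k (Δ_c w k)ᵀ (C c) (Δ_c w k)` with real `3×3` class
matrices (the near form of `NearCertificateF` is of this shape: `classTerm ↦ ω_c ζ_cζ_cᵀ + ψ_c BᵀB`,
`metricForm ↦ BᵀB`, chain charges `↦ (W/‖ζ⁰_s‖) ζ_c(δ)ζ_c(δ)ᵀ` on the step classes, `N0 ↦ 1`). [folklore] -/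
def pairForm (s : Finset BondClass) (C : BondClass → Matrix (Fin 3) (Fin 3) ℝ) (w : Label → E3) : ℝ :=
  ∑ c ∈ s, ∑' k, ∑ i : Fin 3, ∑ j : Fin 3, (bondDiff c w k) i * C c i j * (bondDiff c w k) j

/-- The Bloch DIFFERENCE SYMBOL of class `c = (m, m', n)` applied to a cell amplitude `v : Fin 2 → ℂ³`:
`e^{iθ·n} v_{m'} − v_m`. [folklore] -/
def diffSymbol (c : BondClass) (θ : Fin 3 → ℝ) (v : Fin 2 → Fin 3 → ℂ) : Fin 3 → ℂ :=
  fun i => Complex.exp (Complex.I * ((∑ j : Fin 3, θ j * (c.2.2 j : ℝ) : ℝ) : ℂ)) * v c.2.1 i - v c.1 i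

/-- The value of the 6×6 Hermitian SYMBOL of the pair form at wave vector `θ ∈ ℝ³` (integer-coordinate torus)
on the amplitude `v`: `Σ_{c ∈ s} (D_c v)ᴴ (C c) (D_c v)` (real part; it is real for symmetric `C c`). [folklore] -/
def symbolForm (s : Finset BondClass) (C : BondClass → Matrix (Fin 3) (Fin 3) ℝ) (θ : Fin 3 → ℝ)
    (v : Fin 2 → Fin 3 → ℂ) : ℝ :=
  (∑ c ∈ s, ∑ i : Fin 3, ∑ j : Fin 3, conj (diffSymbol c θ v i) * (C c i j : ℂ) * diffSymbol c θ v j).re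

/-- **BLOCH REDUCTION FOR FINITE-RANGE PAIR FORMS** (Schmidt–Steinbach 2022 Thm 3.22 specialised to the labelled
two-lattice; Plancherel on a finite torus `(ℤ/Lℤ)³` with `L >` support diameter + range suffices): if the symbol is
positive semidefinite at every wave vector then the pair form is nonnegative on every finitely supported field.
Analytic, L-sized, reusable summit-wide (first stub of the hedge line). [cite: SchmidtSteinbach2022, Thm 3.22] -/
def BlochReductionPair : Prop :=
  ∀ (s : Finset BondClass) (C : BondClass → Matrix (Fin 3) (Fin 3) ℝ), (∀ c, (C c).IsSymm) →
    (∀ (θ : Fin 3 → ℝ) (v : Fin 2 → Fin 3 → ℂ), 0 ≤ symbolForm s C θ v) →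
      ∀ w : Label → E3, (Function.support w).Finite → 0 ≤ pairForm s C w

/-- The class matrices of the NEAR PAIR FORM of `NearCertificateF` at a datum, for certificate parameters
`(κ, Rn, Rf, R∞, chain, P)`: exact near range minus `2κ` metric on the nearest-neighbour classes minus the three far
charges (chain charges distributed on the step classes; mid-range and tail constants on `N0`). [folklore] -/
def nearClassMatrix (κ Rn Rf Rinf : ℝ) (chain : BondClass → List BondClass) (P : BondClass → ℝ)
    (A B : E3 →L[ℝ] E3) (δ : E3) (c : BondClass) : Matrix (Fin 3) (Fin 3) ℝ :=
  fun i j =>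
    (if c ∈ classesR Rn then
        omegaLJ ‖A (bondVec δ c)‖ * (bondVec δ c) i * (bondVec δ c) j +
          psiLJ ‖A (bondVec δ c)‖ * inner ℝ (B (EuclideanSpace.single i 1)) (B (EuclideanSpace.single j 1))
      else 0) -
    (if c ∈ nnClasses then
        2 * κ * inner ℝ (B (EuclideanSpace.single i 1)) (B (EuclideanSpace.single j 1)) +
          ((∑ c' ∈ farClasses Rf Rinf, farCoeff c' * P c') + 40000 / Rinf ^ 3) * (if i = j then 1 else 0)
      else 0) -
    ∑ c' ∈ farClasses Rn Rf, if c ∈ chain c' then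
        |omegaLJ ‖A (bondVec δ c')‖| * chainConst (chain c') * ‖bondVec 0 c‖⁻¹ * (bondVec δ c') i * (bondVec δ c') j
      else 0

/-- The finite class support of the near pair form. [folklore] -/
def nearSupport (Rn Rf : ℝ) (chain : BondClass → List BondClass) : Finset BondClass :=
  classesR Rn ∪ nnClasses ∪ (farClasses Rn Rf).biUnion fun c' => (chain c').toFinset

/-- **NEAR SYMBOL CERTIFICATE on the fundamental domain, θ split at `θ₀`** (the computational stubs of the hedge
line): certificate parameters as in `NearCertificateF`, and at every datum of the window ∩ fundamental domain the
symbol of the near pair form is PSD — separately on the long waves `‖θ‖ ≤ θ₀` (acoustic blow-up: the 6×6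
second-order pencil on `S²`, where the window minimum `κ* ≈ 0.105` sits) and on the short waves `θ₀ ≤ ‖θ‖`
(coarse certified interval scan; margin ≥ 0.207 at the worst datum for `‖θ‖∞ ≥ 1/2`). [folklore] -/
def NearSymbolCertificateF (θ₀ : ℝ) : Prop :=
  ∃ κ : ℝ, 0 < κ ∧ ∃ (Rn Rf Rinf : ℝ) (chain : BondClass → List BondClass) (P : BondClass → ℝ),
    2 ≤ Rn ∧ Rn ≤ Rf ∧ Rf ≤ Rinf ∧ 100 ≤ Rinf ∧ ValidChains Rn Rf chain ∧ MidBound Rf Rinf P ∧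
    (∀ (A B : E3 →L[ℝ] E3) (δ : E3), CellWindow A → ShiftWindow A δ → Contragredient A B → StretchOrdered A →
      ∀ (θ : Fin 3 → ℝ) (v : Fin 2 → Fin 3 → ℂ), ‖θ‖ ≤ θ₀ →
        0 ≤ symbolForm (nearSupport Rn Rf chain) (nearClassMatrix κ Rn Rf Rinf chain P A B δ) θ v) ∧
    (∀ (A B : E3 →L[ℝ] E3) (δ : E3), CellWindow A → ShiftWindow A δ → Contragredient A B → StretchOrdered A →
      ∀ (θ : Fin 3 → ℝ) (v : Fin 2 → Fin 3 → ℂ), θ₀ ≤ ‖θ‖ →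
        0 ≤ symbolForm (nearSupport Rn Rf chain) (nearClassMatrix κ Rn Rf Rinf chain P A B δ) θ v)

/-- **Glue of the hedge split** (what its assembly stub would prove): Bloch reduction + the symbol certificate give
`NearCertificateF` — unpack the parameters, rewrite the near inequality of `NearCertificateF` as
`0 ≤ pairForm (nearSupport …) (nearClassMatrix …) w` (finite sums of `tsum`s of products; the chain charge is
redistributed on its step classes), and apply `BlochReductionPair` with the case split `‖θ‖ ≤ θ₀ ∨ θ₀ ≤ ‖θ‖`.
Left as `sorry` in this census sketch (it is the M-sized bookkeeping stub of a line that is NOT registered). -/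
theorem nearCertificateF_of_symbol (θ₀ : ℝ) (hB : BlochReductionPair) (hS : NearSymbolCertificateF θ₀) :
    NearCertificateF := by
  sorry

/-- Units sanity of the sketch: the difference symbol of the diagonal class vanishes at `θ = 0`. [folklore] -/
theorem diffSymbol_diag_zero (v : Fin 2 → Fin 3 → ℂ) (i : Fin 3) :
    diffSymbol ((0 : Fin 2), (0 : Fin 2), (0 : Fin 3 → ℤ)) 0 v i = 0 := by
  simp [diffSymbol]

end Summit.AtomisticToContinuum.Crystallization.Cruxes.PhononStability.StrategistS1

end
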